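import Literature.AlgebraicGeometry.HodgeTheory.HodgeGenericPointOfLociDichotomy
import HarnessLib

/-!
# Generic points off a countable union of SMALL sets (Deligne 1972, Prop. 7.5; André 1992, Lemma 4),
# from an «all, or inside a small closed nowhere-dense set» alternative for the loci

Family `hodge`, layer `Literature/AlgebraicGeometry/HodgeTheory`; proof file (theorems only, no
definition, no named fact). Written by the prover seat `hodge-nonav-prover-Ax` (g13) of the cell
`hodge-nonav` for route `HodgeConjecture/CyclicUnitaryPowers` (crux K1-A, stmt-HodgeConjecture-19544),
programme «AE».

`HodgeGenericPointsComeagreOfLociDichotomy.isMeagre_nonGeneric_of_lociDichotomy` (same seat, g11)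
runs Deligne's Baire argument from the local dichotomy «every locus is all of the chart or NOWHERE
DENSE» and concludes that the non-generic points form a MEAGRE set. The analytic source of the
dichotomy says more — the loci are cut out by holomorphic equations (Voisin II Lemma 5.13; the tree's
`hodgeLoci_subset_zeroSet_of_holomorphicFrame`) — and to transmit that extra information (Lebesgue-null
in charts; countable over one-dimensional bases) this file re-runs the SAME argument with an abstract
smallness predicate `Small : Set U → Prop`:

* `exists_countable_small_cover_of_lociAlternative` — HYPOTHESIS: every point has arbitrarily small
  path-connected open neighbourhoods `W` such that for every property `P i`, every base point `x ∈ W`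
  and every ADMISSIBLE state `Tx` at `x`, the locus of points of `W` at which `P i` holds for the
  continuation of `Tx` inside `W` is either all of `W`, or contained in a set `Z` which is `Small`,
  nowhere dense and closed in `W`. CONCLUSION: there is a COUNTABLE family `𝒞` of sets, each `Small`
  and nowhere dense, such that every admissible state `(t₀, δ₀, T₀)` with `t₀ ∉ ⋃₀ 𝒞` is generic (every
  `P i` holding at `(t₀, T₀)` holds at every `(t, δ, T)`). In particular `⋃₀ 𝒞` is meagre
  (`isMeagre_sUnion_of_countable_isNowhereDense`), recovering the g11 statement; with `Small Z` =
  «`Z` is the zero set in `W` of a holomorphic function on the chart image, not identically zero»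
  (downstream) `⋃₀ 𝒞` is moreover Lebesgue-null in algebraic charts and countable when the base is a
  curve.

Proof: the g11 proof verbatim (charts inside trivialising opens, a countable subcover, the loci based
at the countably many centres and admissible states, `full_of_generic` + `propagate_of_full`), run for
the auxiliary properties `P' i t T := (T admissible) → P i t T`, whose loci based at NON-admissible
states are whole charts (so that `full_of_generic`'s closure condition is only ever needed at
admissible states, where the alternative provides the small set).

## References

* [Deligne1972WeilK3] P. Deligne, La conjecture de Weil pour les surfaces K3, Invent. Math. 15
  (1972), Prop. 7.5.
* [Andre1992] Y. André, Mumford–Tate groups of mixed Hodge structures and the theorem of the fixed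
  part, Compositio Math. 82 (1992), §4 Lemma 4 (p. 7).
* [VoisinHodgeII2003] C. Voisin, Hodge Theory and Complex Algebraic Geometry II (2003), §5.3.1
  Lemma 5.13.
-/

noncomputable section

open CategoryTheory AlgebraicGeometry
open _root_.Topology _root_.Filter
open Literature.AlgebraicTopology.SingularHomology
open Literature.AlgebraicGeometry.Motives

namespace Literature.AlgebraicGeometry.HodgeTheory

section HodgeTheory

section Topology

variable {X : Type*} [TopologicalSpace X]

/-- A countable union of nowhere-dense sets is meagre. [cite: FritzscheGrauert2002, Chapter I §8 (nowhere dense sets), Definition before Proposition 8.1] -/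
theorem isMeagre_sUnion_of_countable_isNowhereDense {𝒞 : Set (Set X)} (h𝒞 : 𝒞.Countable)
    (hnd : ∀ Z ∈ 𝒞, IsNowhereDense Z) : IsMeagre (⋃₀ 𝒞) := by
  rw [Set.sUnion_eq_biUnion]
  exact isMeagre_biUnion h𝒞 fun Z hZ ↦ (hnd Z hZ).isMeagre

/-- A nonempty open set is not nowhere dense. [cite: FritzscheGrauert2002, Chapter I §8 (nowhere dense sets), Definition before Proposition 8.1] -/
theorem not_isNowhereDense_of_isOpen_of_nonempty {W Z : Set X} (hW : IsOpen W) (hne : W.Nonempty)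
    (hWZ : W ⊆ Z) : ¬ IsNowhereDense Z := by
  intro h
  rw [IsNowhereDense] at h
  obtain ⟨t, ht⟩ := hne
  have htI : t ∈ interior (closure Z) :=
    interior_mono (hWZ.trans subset_closure) (by rwa [hW.interior_eq])
  rw [h] at htI
  exact htI

end Topology

section Generic

variable {𝒳 S : SchemeOver ℂ} (f : 𝒳 ⟶ S) (k : ℕ) {U : Set (ComplexPoints S)}
  (hU : IsCohomologicallyLocallyTrivialOn f U)

/-- Admissibility is transmitted along continuations: if `T'` is a rational transport from `s` along
some path class and `T` is related to `T'` by transport along `ε`, then `T` is a rational transport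
from `s` along some path class. [cite: VoisinHodgeI2002, §9.2.1] -/
theorem admissible_of_related {s x t : U}
    {T' : singularCohomology ℚ ℚ (ComplexPoints (fiberOver f s.1)) k ≃ₗ[ℚ]
      singularCohomology ℚ ℚ (ComplexPoints (fiberOver f x.1)) k}
    (hT' : ∃ δ : Path.Homotopic.Quotient s x,
      ∀ v, ofRatClass _ k (T' v) = transportFun f k hU δ (ofRatClass _ k v))
    (ε : Path x t)
    {T : singularCohomology ℚ ℚ (ComplexPoints (fiberOver f s.1)) k ≃ₗ[ℚ]
      singularCohomology ℚ ℚ (ComplexPoints (fiberOver f t.1)) k}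
    (hT : ∀ v, ofRatClass _ k (T v) = transportFun f k hU ⟦ε⟧ (ofRatClass _ k (T' v))) :
    ∃ δ : Path.Homotopic.Quotient s t,
      ∀ v, ofRatClass _ k (T v) = transportFun f k hU δ (ofRatClass _ k v) := by
  obtain ⟨δ, hδ⟩ := hT'
  exact ⟨δ.trans ⟦ε⟧, fun v ↦ by rw [hT v, hδ v, transportFun_trans]⟩

/-- Conversely, admissibility passes back along a continuation: if `T` (related to `T'` along `ε`)
is a rational transport from `s` along some path class, so is `T'`. [cite: VoisinHodgeI2002, §9.2.1] -/
theorem admissible_of_related_symm {s x t : U}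
    {T' : singularCohomology ℚ ℚ (ComplexPoints (fiberOver f s.1)) k ≃ₗ[ℚ]
      singularCohomology ℚ ℚ (ComplexPoints (fiberOver f x.1)) k}
    (ε : Path x t)
    {T : singularCohomology ℚ ℚ (ComplexPoints (fiberOver f s.1)) k ≃ₗ[ℚ]
      singularCohomology ℚ ℚ (ComplexPoints (fiberOver f t.1)) k}
    (hT : ∀ v, ofRatClass _ k (T v) = transportFun f k hU ⟦ε⟧ (ofRatClass _ k (T' v)))
    (hTadm : ∃ δ : Path.Homotopic.Quotient s t,
      ∀ v, ofRatClass _ k (T v) = transportFun f k hU δ (ofRatClass _ k v)) :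
    ∃ δ : Path.Homotopic.Quotient s x,
      ∀ v, ofRatClass _ k (T' v) = transportFun f k hU δ (ofRatClass _ k v) := by
  obtain ⟨δ, hδ⟩ := hTadm
  refine ⟨δ.trans ⟦ε.symm⟧, fun v ↦ ?_⟩
  rw [transportFun_trans, ← hδ v, hT v, transportFun_mk_symm_mk]

/-- **Generic points off a countable union of small sets (Deligne 1972, Prop. 7.5; André 1992,
Lemma 4 — abstract form of the Baire argument, keeping track of the exceptional loci).** Let
`f : 𝒳 ⟶ S` be cohomologically locally trivial over `U ⊆ S(ℂ)` in degree `k`, with transport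
preserving rational classes, `U` locally path connected and second countable, the rational fibres
finite-dimensional, `P i t T` (`i` in a countable set) properties of the rational transports
`T : Hᵏ(X_s; ℚ) ≃ Hᵏ(X_t; ℚ)`, and `Small` any predicate on subsets of `U`. HYPOTHESIS (local
alternative): every point has arbitrarily small path-connected open neighbourhoods `W` such that for
every `i`, every base point `x ∈ W` and every ADMISSIBLE state `Tx` at `x` (a rational transport from
`s` along some path class), the locus of points `t ∈ W` at which `P i` holds for the continuation of
`Tx` along paths inside `W` is either all of `W`, or contained in some `Z ⊆ U` which is `Small`,
nowhere dense, and closed in `W`. CONCLUSION: there is a COUNTABLE family `𝒞` of subsets of `U`, each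
`Small` and nowhere dense, such that every admissible state `(t₀, δ₀, T₀)` with `t₀ ∉ ⋃₀ 𝒞` is
generic: every `P i` holding at `(t₀, T₀)` holds at every `(t, δ, T)`. (`𝒞` consists of the small sets
provided by the alternative at the centres of a countable subcover by such charts and the countably
many admissible states there.) [cite: Deligne1972WeilK3, Prop. 7.5] [cite: Andre1992, §4 Lemma 4]
[cite: VoisinHodgeII2003, §5.3.1 Lemma 5.13] -/
theorem exists_countable_small_cover_of_lociAlternative [LocallyPathConnectedSpace U]
    [SecondCountableTopology U]
    [∀ x : U, Module.Finite ℚ (singularCohomology ℚ ℚ (ComplexPoints (fiberOver f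
      (Subtype.val x))) k)] (s : U)
    (hrat : ∀ (x y : U) (γ : Path.Homotopic.Quotient x y) (α : complexBetti (fiberOver f x.1) k),
      IsRationalClass α → IsRationalClass (transportFun f k hU γ α))
    {ι : Type*} [Countable ι] (P : ι → ∀ t : U, (singularCohomology ℚ ℚ (ComplexPoints (fiberOver f
      (Subtype.val s))) k ≃ₗ[ℚ]
      singularCohomology ℚ ℚ (ComplexPoints (fiberOver f (Subtype.val t))) k) → Prop)
    (Small : Set U → Prop)
    (hloc : ∀ (t₁ : U), ∀ N ∈ 𝓝 t₁, ∃ W : Set U, IsOpen W ∧ t₁ ∈ W ∧ W ⊆ N ∧ IsPathConnected W ∧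
      ∀ (i : ι) (x : U), x ∈ W → ∀ (Tx : singularCohomology ℚ ℚ (ComplexPoints (fiberOver f (Subtype.val s))) k ≃ₗ[ℚ]
        singularCohomology ℚ ℚ (ComplexPoints (fiberOver f (Subtype.val x))) k),
        (∃ δ : Path.Homotopic.Quotient s x,
          ∀ v, ofRatClass _ k (Tx v) = transportFun f k hU δ (ofRatClass _ k v)) →
        (∀ t ∈ W, ∀ (ε : Path x t), (∀ r, ε r ∈ W) → ∀ (T : singularCohomology ℚ ℚ (ComplexPoints (fiberOver f
          (Subtype.val s))) k ≃ₗ[ℚ]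
          singularCohomology ℚ ℚ (ComplexPoints (fiberOver f (Subtype.val t))) k),
          (∀ v, ofRatClass _ k (T v) = transportFun f k hU ⟦ε⟧ (ofRatClass _ k (Tx v))) →
            P i t T) ∨
        ∃ Z : Set U, Small Z ∧ IsNowhereDense Z ∧ (∀ t ∈ W, t ∈ closure Z → t ∈ Z) ∧
          {t : U | t ∈ W ∧ ∀ (ε : Path x t), (∀ r, ε r ∈ W) →
            ∀ (T : singularCohomology ℚ ℚ (ComplexPoints (fiberOver f (Subtype.val s))) k ≃ₗ[ℚ]
              singularCohomology ℚ ℚ (ComplexPoints (fiberOver f (Subtype.val t))) k),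
            (∀ v, ofRatClass _ k (T v) = transportFun f k hU ⟦ε⟧ (ofRatClass _ k (Tx v))) →
              P i t T} ⊆ Z) :
    ∃ 𝒞 : Set (Set U), 𝒞.Countable ∧ (∀ Z ∈ 𝒞, Small Z ∧ IsNowhereDense Z) ∧
      ∀ t₀ ∉ ⋃₀ 𝒞, ∀ (δ₀ : Path.Homotopic.Quotient s t₀)
      (T₀ : singularCohomology ℚ ℚ (ComplexPoints (fiberOver f (Subtype.val s))) k ≃ₗ[ℚ]
        singularCohomology ℚ ℚ (ComplexPoints (fiberOver f (Subtype.val t₀))) k),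
      (∀ v, ofRatClass _ k (T₀ v) = transportFun f k hU δ₀ (ofRatClass _ k v)) →
      ∀ i, P i t₀ T₀ → ∀ (t : U) (δ : Path.Homotopic.Quotient s t) (T : singularCohomology ℚ ℚ (ComplexPoints
        (fiberOver f (Subtype.val s))) k ≃ₗ[ℚ]
        singularCohomology ℚ ℚ (ComplexPoints (fiberOver f (Subtype.val t))) k),
        (∀ v, ofRatClass _ k (T v) = transportFun f k hU δ (ofRatClass _ k v)) → P i t T := by
  classical
  -- the auxiliary properties `P' i t T := (T admissible) → P i t T`
  let Adm : ∀ t : U, (singularCohomology ℚ ℚ (ComplexPoints (fiberOver f (Subtype.val s))) k ≃ₗ[ℚ]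
      singularCohomology ℚ ℚ (ComplexPoints (fiberOver f (Subtype.val t))) k) → Prop :=
    fun t T ↦ ∃ δ : Path.Homotopic.Quotient s t,
      ∀ v, ofRatClass _ k (T v) = transportFun f k hU δ (ofRatClass _ k v)
  let P' : ι → ∀ t : U, (singularCohomology ℚ ℚ (ComplexPoints (fiberOver f (Subtype.val s))) k ≃ₗ[ℚ]
      singularCohomology ℚ ℚ (ComplexPoints (fiberOver f (Subtype.val t))) k) → Prop :=
    fun i t T ↦ Adm t T → P i t T
  -- Step 1: charts `W ⊆ B` (path-connected opens inside trivialising opens) around every point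
  have hchart : ∀ t₁ : U, ∃ (W : Set U) (B : Set (ComplexPoints S)), IsOpen W ∧ t₁ ∈ W ∧
      IsPathConnected W ∧ IsOpen B ∧ B ⊆ U ∧ (∀ t ∈ W, (t : ComplexPoints S) ∈ B) ∧
      (∀ ⦃z⦄ (hz : z ∈ B), Function.Bijective (fiberRestrict f hz k)) ∧
      ∀ (i : ι) (x : U), x ∈ W → ∀ (Tx : singularCohomology ℚ ℚ (ComplexPoints (fiberOver f (Subtype.val s))) k ≃ₗ[ℚ]
        singularCohomology ℚ ℚ (ComplexPoints (fiberOver f (Subtype.val x))) k),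
        Adm x Tx →
        (∀ t ∈ W, ∀ (ε : Path x t), (∀ r, ε r ∈ W) → ∀ (T : singularCohomology ℚ ℚ (ComplexPoints (fiberOver f
          (Subtype.val s))) k ≃ₗ[ℚ]
          singularCohomology ℚ ℚ (ComplexPoints (fiberOver f (Subtype.val t))) k),
          (∀ v, ofRatClass _ k (T v) = transportFun f k hU ⟦ε⟧ (ofRatClass _ k (Tx v))) →
            P i t T) ∨
        ∃ Z : Set U, Small Z ∧ IsNowhereDense Z ∧ (∀ t ∈ W, t ∈ closure Z → t ∈ Z) ∧
          {t : U | t ∈ W ∧ ∀ (ε : Path x t), (∀ r, ε r ∈ W) →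
            ∀ (T : singularCohomology ℚ ℚ (ComplexPoints (fiberOver f (Subtype.val s))) k ≃ₗ[ℚ]
              singularCohomology ℚ ℚ (ComplexPoints (fiberOver f (Subtype.val t))) k),
            (∀ v, ofRatClass _ k (T v) = transportFun f k hU ⟦ε⟧ (ofRatClass _ k (Tx v))) →
              P i t T} ⊆ Z := by
    intro t₁
    obtain ⟨B, hBo, ht₁B, -, hBU, hbij⟩ := hU.exists_nhds_bijective t₁.2 Set.univ Filter.univ_mem
    have hN : (Subtype.val ⁻¹' B : Set U) ∈ 𝓝 t₁ :=
      (hBo.preimage continuous_subtype_val).mem_nhds ht₁B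
    obtain ⟨W, hWo, ht₁W, hWN, hWpc, hW⟩ := hloc t₁ _ hN
    exact ⟨W, B, hWo, ht₁W, hWpc, hBo, hBU, fun t ht ↦ hWN ht, fun z hz ↦ hbij k hz, hW⟩
  choose Wp Bp hWo ht₁W hWpc hBo hBU hWB hbij hdichp using hchart
  -- Step 2: a countable subcover
  obtain ⟨Cset, hCc, hCU⟩ := TopologicalSpace.isOpen_iUnion_countable Wp hWo
  have hcov : ∀ t : U, ∃ c : Cset, t ∈ Wp c.1 := by
    intro t
    have ht : t ∈ ⋃ i ∈ Cset, Wp i := by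
      rw [hCU]
      exact Set.mem_iUnion.2 ⟨t, ht₁W t⟩
    obtain ⟨i, hi⟩ := Set.mem_iUnion.1 ht
    obtain ⟨hi, hti⟩ := Set.mem_iUnion.1 hi
    exact ⟨⟨i, hi⟩, hti⟩
  haveI : Countable Cset := hCc.to_subtype
  haveI : ∀ x : U, Countable (singularCohomology ℚ ℚ (ComplexPoints (fiberOver f (Subtype.val s))) k ≃ₗ[ℚ]
    singularCohomology ℚ ℚ (ComplexPoints (fiberOver f (Subtype.val x))) k) :=
    fun x ↦ countable_linearEquiv_rat _ _
  -- Step 3: the `P`-loci and `P'`-loci based at a point of a chart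
  obtain ⟨L, hL⟩ : ∃ L : ∀ (c : Cset) (i : ι) (x : U), (singularCohomology ℚ ℚ (ComplexPoints (fiberOver f
    (Subtype.val s))) k ≃ₗ[ℚ]
    singularCohomology ℚ ℚ (ComplexPoints (fiberOver f (Subtype.val x))) k) → Set U,
      ∀ c i x T', L c i x T' = {t : U | t ∈ Wp c.1 ∧ ∀ (ε : Path x t), (∀ r, ε r ∈ Wp c.1) →
        ∀ (T : singularCohomology ℚ ℚ (ComplexPoints (fiberOver f (Subtype.val s))) k ≃ₗ[ℚ]
          singularCohomology ℚ ℚ (ComplexPoints (fiberOver f (Subtype.val t))) k),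
        (∀ v, ofRatClass _ k (T v) = transportFun f k hU ⟦ε⟧ (ofRatClass _ k (T' v))) →
          P i t T} := ⟨_, fun _ _ _ _ ↦ rfl⟩
  obtain ⟨L', hL'⟩ : ∃ L' : ∀ (c : Cset) (i : ι) (x : U), (singularCohomology ℚ ℚ (ComplexPoints (fiberOver f
    (Subtype.val s))) k ≃ₗ[ℚ]
    singularCohomology ℚ ℚ (ComplexPoints (fiberOver f (Subtype.val x))) k) → Set U,
      ∀ c i x T', L' c i x T' = {t : U | t ∈ Wp c.1 ∧ ∀ (ε : Path x t), (∀ r, ε r ∈ Wp c.1) →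
        ∀ (T : singularCohomology ℚ ℚ (ComplexPoints (fiberOver f (Subtype.val s))) k ≃ₗ[ℚ]
          singularCohomology ℚ ℚ (ComplexPoints (fiberOver f (Subtype.val t))) k),
        (∀ v, ofRatClass _ k (T v) = transportFun f k hU ⟦ε⟧ (ofRatClass _ k (T' v))) →
          P' i t T} := ⟨_, fun _ _ _ _ ↦ rfl⟩
  -- (a) at an admissible state the two loci agree
  have hL'L : ∀ c i x T', Adm x T' → L' c i x T' ⊆ L c i x T' := by
    intro c i x T' hT' t ht
    rw [hL'] at ht
    rw [hL]
    exact ⟨ht.1, fun ε hε T hT ↦ ht.2 ε hε T hT (admissible_of_related f k hU hT' ε hT)⟩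
  -- (b) at a non-admissible state the `P'`-locus is the whole chart
  have hL'full : ∀ c i x T', ¬ Adm x T' → Wp c.1 ⊆ L' c i x T' := by
    intro c i x T' hT' t ht
    rw [hL']
    exact ⟨ht, fun ε _ T hT hTadm ↦ (hT' (admissible_of_related_symm f k hU ε hT hTadm)).elim⟩
  -- (c) when `P` is full on the chart, so is `P'`
  have hL'full' : ∀ c i x T', (∀ t ∈ Wp c.1, ∀ (ε : Path x t), (∀ r, ε r ∈ Wp c.1) →
      ∀ (T : singularCohomology ℚ ℚ (ComplexPoints (fiberOver f (Subtype.val s))) k ≃ₗ[ℚ]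
        singularCohomology ℚ ℚ (ComplexPoints (fiberOver f (Subtype.val t))) k),
      (∀ v, ofRatClass _ k (T v) = transportFun f k hU ⟦ε⟧ (ofRatClass _ k (T' v))) → P i t T) →
      Wp c.1 ⊆ L' c i x T' := by
    intro c i x T' hfull t ht
    rw [hL']
    exact ⟨ht, fun ε hε T hT _ ↦ hfull t ht ε hε T hT⟩
  -- Step 4: the small sets attached to the centres and the admissible states there
  have hZex : ∀ (c : Cset) (i : ι) (T' : singularCohomology ℚ ℚ (ComplexPoints (fiberOver f
      (Subtype.val s))) k ≃ₗ[ℚ]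
      singularCohomology ℚ ℚ (ComplexPoints (fiberOver f (Subtype.val c.1))) k),
      ∃ Z : Set U, (Z = ∅ ∨ (Small Z ∧ IsNowhereDense Z)) ∧ IsNowhereDense Z ∧
        (∀ t ∈ Wp c.1, t ∈ closure Z → t ∈ Z) ∧
        (Adm c.1 T' → Wp c.1 ⊆ L' c i c.1 T' ∨ L c i c.1 T' ⊆ Z) := by
    intro c i T'
    by_cases hT' : Adm c.1 T'
    · rcases hdichp c.1 i c.1 (ht₁W c.1) T' hT' with hfull | ⟨Z, hZs, hZnd, hZcl, hLZ⟩
      · refine ⟨∅, Or.inl rfl, isNowhereDense_empty, fun t _ ht ↦ ?_, fun _ ↦ Or.inl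
          (hL'full' c i c.1 T' hfull)⟩
        rwa [closure_empty] at ht
      · refine ⟨Z, Or.inr ⟨hZs, hZnd⟩, hZnd, hZcl, fun _ ↦ Or.inr ?_⟩
        rw [hL]
        exact hLZ
    · refine ⟨∅, Or.inl rfl, isNowhereDense_empty, fun t _ ht ↦ ?_, fun h ↦ (hT' h).elim⟩
      rwa [closure_empty] at ht
  choose Zc hZc hZnd hZcl hZalt using hZex
  -- the exceptional family: the non-empty small sets among the `Zc`
  refine ⟨{Z | Z ∈ Set.range (fun q : Σ c : Cset, ι × (singularCohomology ℚ ℚ (ComplexPoints (fiberOver f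
      (Subtype.val s))) k ≃ₗ[ℚ]
      singularCohomology ℚ ℚ (ComplexPoints (fiberOver f (Subtype.val c.1))) k) ↦ Zc q.1 q.2.1 q.2.2) ∧
      (Small Z ∧ IsNowhereDense Z)},
    (Set.countable_range _).mono fun Z hZ ↦ hZ.1, fun Z hZ ↦ hZ.2, ?_⟩
  intro t₀ ht₀ δ₀ T₀ hT₀ i hP t δ T hT
  -- Step 5: `t₀` lies in none of the `Zc`
  have hgen : ∀ (c : Cset) (T' : singularCohomology ℚ ℚ (ComplexPoints (fiberOver f (Subtype.val s))) k ≃ₗ[ℚ]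
      singularCohomology ℚ ℚ (ComplexPoints (fiberOver f (Subtype.val c.1))) k), t₀ ∉ Zc c i T' := by
    intro c T' hmem
    rcases hZc c i T' with h | h
    · rw [h] at hmem
      exact hmem
    · exact ht₀ (Set.mem_sUnion.2 ⟨Zc c i T', ⟨⟨⟨c, i, T'⟩, rfl⟩, h⟩, hmem⟩)
  -- the dichotomy for `P'` in the shape `full_of_generic` / `propagate_of_full` consume
  have hdich' : ∀ (c : Cset) (x : U), x ∈ Wp c.1 → ∀ (Tx : singularCohomology ℚ ℚ (ComplexPoints (fiberOver f
      (Subtype.val s))) k ≃ₗ[ℚ]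
      singularCohomology ℚ ℚ (ComplexPoints (fiberOver f (Subtype.val x))) k),
      Adm x Tx →
      (∀ t ∈ Wp c.1, ∀ (ε : Path x t), (∀ r, ε r ∈ Wp c.1) → ∀ (T : singularCohomology ℚ ℚ (ComplexPoints
        (fiberOver f (Subtype.val s))) k ≃ₗ[ℚ]
        singularCohomology ℚ ℚ (ComplexPoints (fiberOver f (Subtype.val t))) k),
        (∀ v, ofRatClass _ k (T v) = transportFun f k hU ⟦ε⟧ (ofRatClass _ k (Tx v))) → P' i t T) ∨
      IsNowhereDense {t : U | t ∈ Wp c.1 ∧ ∀ (ε : Path x t), (∀ r, ε r ∈ Wp c.1) →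
        ∀ (T : singularCohomology ℚ ℚ (ComplexPoints (fiberOver f (Subtype.val s))) k ≃ₗ[ℚ]
          singularCohomology ℚ ℚ (ComplexPoints (fiberOver f (Subtype.val t))) k),
        (∀ v, ofRatClass _ k (T v) = transportFun f k hU ⟦ε⟧ (ofRatClass _ k (Tx v))) → P' i t T} := by
    intro c x hx Tx hTx
    rcases hdichp c.1 i x hx Tx hTx with hfull | ⟨Z, -, hZnd', -, hLZ⟩
    · exact Or.inl fun t ht ε hε T hT _ ↦ hfull t ht ε hε T hT
    · right
      refine hZnd'.mono (Set.Subset.trans ?_ hLZ)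
      have h := hL'L c i x Tx hTx
      rw [hL', hL] at h
      exact h
  -- Step 6: fullness of `P'` at `t₀` in every chart through it, then propagation
  have hfull₀ : ∀ c : Cset, t₀ ∈ Wp c.1 → ∀ t' ∈ Wp c.1, ∀ (ε : Path t₀ t'), (∀ r, ε r ∈ Wp c.1) →
      ∀ (T' : singularCohomology ℚ ℚ (ComplexPoints (fiberOver f (Subtype.val s))) k ≃ₗ[ℚ]
        singularCohomology ℚ ℚ (ComplexPoints (fiberOver f (Subtype.val t'))) k),
      (∀ v, ofRatClass _ k (T' v) = transportFun f k hU ⟦ε⟧ (ofRatClass _ k (T₀ v))) → P' i t' T' := by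
    intro c hc
    refine full_of_generic f k hU s hrat (P' i) (hWpc c.1) (hBo c.1) (hbij c.1) (hWB c.1)
      (ht₁W c.1) hc hT₀ (fun _ ↦ hP) (fun T' hnd ↦ ?_) (fun T' hT' ↦ hdich' c c.1 (ht₁W c.1) T' hT')
    -- the closure condition, needed only where the `P'`-locus is nowhere dense
    have hnd' : IsNowhereDense (L' c i c.1 T') := by rwa [hL']
    by_cases hT' : Adm c.1 T'
    · rcases hZalt c i T' hT' with hfull | hLZ
      · exact ((not_isNowhereDense_of_isOpen_of_nonempty (hWo c.1) ⟨_, ht₁W c.1⟩ hfull) hnd').elim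
      · intro hcl
        have hcl' : t₀ ∈ closure (L' c i c.1 T') := by rwa [hL']
        exact hgen c T' (hZcl c i T' t₀ hc
          (closure_mono ((hL'L c i c.1 T' hT').trans hLZ) hcl'))
    · exact ((not_isNowhereDense_of_isOpen_of_nonempty (hWo c.1) ⟨_, ht₁W c.1⟩
        (hL'full c i c.1 T' hT')) hnd').elim
  exact propagate_of_full f k hU s hrat (P' i) (Module.finBasis ℚ (singularCohomology ℚ ℚ (ComplexPoints
    (fiberOver f (Subtype.val s))) k))
    (fun c : Cset ↦ Wp c.1) (fun c ↦ Bp c.1) (fun c ↦ hWo c.1) (fun c ↦ hWpc c.1)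
    (fun c ↦ hBo c.1) (fun c ↦ hBU c.1) (fun c ↦ hbij c.1) (fun c ↦ hWB c.1) hcov
    (fun c x hx Tx hTx ↦ hdich' c x hx Tx hTx) hT₀ hfull₀ δ T hT ⟨δ, hT⟩

end Generic

end HodgeTheory

end Literature.AlgebraicGeometry.HodgeTheory

end
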